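import Mathlib
import HarnessLib

/-!
# Stub A `stub_dilutePolymerGasSum` of line `kinetic-polymer-gas-on-the-time-axis`
(crux `EmbeddedDrudeMourre.DrudeDissolution`, item stmt-AtomisticToContinuum-12593; `--supports`
file proving the registered stub A verbatim, closes nothing)

WHAT. The abstract De Roeck–Kupiainen summation theorem in the DISSIPATIVE case `R = 0`
(De Roeck–Kupiainen, "Return to equilibrium for weakly coupled quantum systems: a simple polymer
expansion", arXiv:1005.1080, §2.2 eq. (2.12), Assumptions 2.2–2.3, Theorem 2.4), as pure
normed-ring combinatorics. In a real normed ring let a "monomer" `T` with `‖Tⁿ‖ ≤ C(1−g)ⁿ`, a final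
partial step `X` with `‖X‖ ≤ 1`, and legs `act N A ι τ` be given; suppose the Kotecký–Preiss
weighted activities (Kotecký–Preiss 1986, weight `r^{|A|}`, `r = C/(1−g)`) of the polymers `(A, ι)`,
`A ⊆ {1,…,N+1}`, `|A| ≥ 2`, anchored at `max A = τ₀` sum to `≤ δ` for every anchor, and that
`Z N − X Tᴺ` is the sum over non-empty collections of polymers with pairwise disjoint supports of
the time-ordered slot products (slot `N+1` carries `X`, slots `≤ N` carry `T`, a covered slot its
leg). THEN `Σ_N ‖Z N − X Tᴺ‖ ≤ 8Cδ/g²` for `δ ≤ g/4`.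

PROOF (elementary because EVERY `T`-string decays; no Feynman rule / Ward identity).
* `norm_pow_mul_prod_map_le_of_runs`: grouping maximal `T`-runs into powers,
  `‖Tᵐ · Π slots‖ ≤ C r^{m+#slots} Π_{legs} (C/r) ‖leg‖` by induction on the slot list.
* `norm_timeOrdered_prod_le`: per collection `𝒞`, `‖term 𝒞‖ ≤ C rᴺ Π_{p∈𝒞} w(p)` with
  `w(A,ι) = (C/r)^{|A|} Π_{τ∈A} ‖act N A ι τ‖` (a slot is covered by at most one polymer;
  reindex slots `i ↔ τ = N+1−i`).
* `summable_norm_le_exp_sub_one_of_gas`: `Σ_{𝒞≠∅} Π_{p∈𝒞} w(p) ≤ Π_p (1 + w p) − 1 ≤ e^{W} − 1`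
  from bounded partial sums `Σ_{p∈B} w p ≤ W` (`Finset.prod_one_add`, `Real.add_one_le_exp`).
* `sum_activity_le_of_slices`: `W = (N+1)δ` by slicing the polymers by their anchor
  `max A ∈ {1,…,N+1}` and converting the `ℝ≥0∞` slice bounds.
* Finally `Σ_N C(1−g)ᴺ(e^{(N+1)δ} − 1) = C(e^δ − 1)/(g(1 − (1−g)e^δ)) ≤ 4Cδ/g² ≤ 8Cδ/g²`
  (`e^δ − 1 ≤ 2δ`, `1 − (1−g)e^δ ≥ g/2` for `δ ≤ g/4`; two geometric series).
-/

noncomputable section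

open scoped BigOperators ENNReal

namespace Summit.AtomisticToContinuum.FouriersLaw.Theorems.DrudeDissolution.KineticPolymerGasOnTheTimeAxis

/-- **Run-grouping norm bound.** If `‖Tⁿ‖ ≤ C rⁿ` (`r > 0`) and `f a = T` on the `T`-slots, then
for every slot list `l`, `‖Tᵐ · Π_{a∈l} f a‖ ≤ C r^{m + |l|} Π_{a ∈ l, ¬T-slot} (C/r) ‖f a‖`:
maximal runs of `T` are grouped into powers (it is the BOUND that needs grouping, the product is
unchanged), each non-`T` slot costs a restart factor `C` and a missing `r`. [folklore] -/
theorem norm_pow_mul_prod_map_le_of_runs {R : Type*} [NormedRing R] (T : R) {C r : ℝ} (hr : 0 < r)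
    (hT : ∀ n : ℕ, ‖T ^ n‖ ≤ C * r ^ n) {ι : Type*} (f : ι → R) (isT : ι → Prop)
    [DecidablePred isT] (hf : ∀ a, isT a → f a = T) (l : List ι) (m : ℕ) :
    ‖T ^ m * (l.map f).prod‖ ≤ C * r ^ (m + l.length) *
      (l.map (fun a => if isT a then (1 : ℝ) else C / r * ‖f a‖)).prod := by
  induction l generalizing m with
  | nil => simpa using hT m
  | cons a l ih =>
    by_cases ha : isT a
    · have h := ih (m + 1)
      simp only [List.map_cons, List.prod_cons, hf a ha, if_pos ha, one_mul, List.length_cons]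
      calc ‖T ^ m * (T * (l.map f).prod)‖ = ‖T ^ (m + 1) * (l.map f).prod‖ := by
            rw [pow_succ, mul_assoc]
        _ ≤ _ := h
        _ = _ := by ring_nf
    · have h0 := ih 0
      simp only [pow_zero, one_mul, zero_add] at h0
      have hP : 0 ≤ C * r ^ l.length *
          (l.map (fun a => if isT a then (1 : ℝ) else C / r * ‖f a‖)).prod :=
        (norm_nonneg _).trans h0
      simp only [List.map_cons, List.prod_cons, if_neg ha, List.length_cons]
      calc ‖T ^ m * (f a * (l.map f).prod)‖ ≤ ‖T ^ m‖ * (‖f a‖ * ‖(l.map f).prod‖) :=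
            (norm_mul_le _ _).trans (mul_le_mul_of_nonneg_left (norm_mul_le _ _) (norm_nonneg _))
        _ ≤ (C * r ^ m) * (‖f a‖ * (C * r ^ l.length *
              (l.map (fun a => if isT a then (1 : ℝ) else C / r * ‖f a‖)).prod)) :=
            mul_le_mul (hT m) (mul_le_mul_of_nonneg_left h0 (norm_nonneg _)) (by positivity)
              ((norm_nonneg _).trans (hT m))
        _ = _ := by
            rw [pow_add, pow_succ]
            field_simp

/-- A list product over `List.range n` is the `Finset.range n` product (commutative monoid).
[folklore] -/
theorem list_prod_map_range_eq_finset_prod {M : Type*} [CommMonoid M] (h : ℕ → M) (n : ℕ) :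
    ((List.range n).map h).prod = ∏ j ∈ Finset.range n, h j := by
  induction n with
  | zero => simp
  | succ n ih => rw [List.range_succ, List.map_append, List.prod_append, ih,
      Finset.prod_range_succ]; simp

/-- **Per-configuration bound** (De Roeck–Kupiainen (2.12), one term, `R = 0`): the time-ordered
product of a collection `𝒞` of polymers with pairwise disjoint supports in `{1, …, N+1}` (slot `i`
carries time `N+1-i`; uncovered slot `0` carries `X`, other uncovered slots carry `T`, a covered
slot the leg of the unique polymer covering it) has norm at most
`C rᴺ ∏_{(A,ι) ∈ 𝒞} (C/r)^{|A|} ∏_{τ ∈ A} ‖act N A ι τ‖` when `‖Tⁿ‖ ≤ C rⁿ`, `‖X‖ ≤ 1`, `1 ≤ C`,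
`0 < r ≤ 1`. [folklore] -/
theorem norm_timeOrdered_prod_le {R : Type*} [NormedRing R] (T X : R)
    (act : ℕ → Finset ℕ → ℕ → ℕ → R) {C r : ℝ} (hC : 1 ≤ C) (hr : 0 < r) (hr1 : r ≤ 1)
    (hT : ∀ n : ℕ, ‖T ^ n‖ ≤ C * r ^ n) (hX : ‖X‖ ≤ 1) (N : ℕ) (𝒞 : Finset (Finset ℕ × ℕ))
    (h𝒞 : ∀ p ∈ 𝒞, p.1 ⊆ Finset.Icc 1 (N + 1) ∧ 2 ≤ p.1.card)
    (hdisj : (𝒞 : Set (Finset ℕ × ℕ)).PairwiseDisjoint Prod.fst) :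
    ‖((List.range (N + 1)).map (fun i : ℕ =>
        if (𝒞.filter (fun p => N + 1 - i ∈ p.1)) = ∅ then (if i = 0 then X else T)
        else ∑ p ∈ 𝒞.filter (fun p => N + 1 - i ∈ p.1), act N p.1 p.2 (N + 1 - i))).prod‖ ≤
      C * r ^ N * ∏ p ∈ 𝒞, ((C / r) ^ p.1.card * ∏ τ ∈ p.1, ‖act N p.1 p.2 τ‖) := by
  set f : ℕ → R := fun i : ℕ =>
    if (𝒞.filter (fun p => N + 1 - i ∈ p.1)) = ∅ then (if i = 0 then X else T)
    else ∑ p ∈ 𝒞.filter (fun p => N + 1 - i ∈ p.1), act N p.1 p.2 (N + 1 - i) with hf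
  set H : ℕ → ℝ := fun i : ℕ =>
    if (𝒞.filter (fun p => N + 1 - i ∈ p.1)) = ∅ then (1 : ℝ)
    else C / r * ‖∑ p ∈ 𝒞.filter (fun p => N + 1 - i ∈ p.1), act N p.1 p.2 (N + 1 - i)‖ with hH
  have hCr : 1 ≤ C / r := (one_le_div hr).2 (hr1.trans hC)
  -- Step 1: split off the head slot `i = 0` (time `N + 1`)
  have hsplit : (List.range (N + 1)).map f = f 0 :: (List.range N).map (fun j => f (j + 1)) := by
    rw [List.range_succ_eq_map, List.map_cons, List.map_map]
    rfl
  -- Step 2: the run bound on the tail (slots `1, …, N`, times `N, …, 1`)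
  have htail : ‖((List.range N).map (fun j => f (j + 1))).prod‖ ≤
      C * r ^ N * ∏ j ∈ Finset.range N, H (j + 1) := by
    have key := norm_pow_mul_prod_map_le_of_runs T hr hT (fun j => f (j + 1))
      (fun j => 𝒞.filter (fun p => N + 1 - (j + 1) ∈ p.1) = ∅) (fun j hj => by
        simp only [hf]
        rw [if_pos hj, if_neg (Nat.succ_ne_zero j)]) (List.range N) 0
    rw [pow_zero, one_mul, zero_add, List.length_range, list_prod_map_range_eq_finset_prod] at key
    refine key.trans (le_of_eq ?_)
    congr 1
    refine Finset.prod_congr rfl fun j _ => ?_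
    by_cases hj : 𝒞.filter (fun p => N + 1 - (j + 1) ∈ p.1) = ∅
    · simp only [hH, if_pos hj]
    · simp only [hH, hf, if_neg hj]
  -- Step 3: the head factor (`X` if uncovered, a leg otherwise)
  have hhead : ‖f 0‖ ≤ H 0 := by
    by_cases h0 : 𝒞.filter (fun p => N + 1 - 0 ∈ p.1) = ∅
    · simp only [hf, hH, if_pos h0]
      exact hX
    · simp only [hf, hH, if_neg h0]
      exact le_mul_of_one_le_left (norm_nonneg _) hCr
  -- Step 4: the slot product equals the polymer product
  have hprod : ∏ i ∈ Finset.range (N + 1), H i =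
      ∏ p ∈ 𝒞, ((C / r) ^ p.1.card * ∏ τ ∈ p.1, ‖act N p.1 p.2 τ‖) := by
    -- (a) each slot weight is a product over the collection (at most one polymer covers a slot)
    have h4a : ∀ i, H i = ∏ p ∈ 𝒞,
        (if N + 1 - i ∈ p.1 then C / r * ‖act N p.1 p.2 (N + 1 - i)‖ else 1) := by
      intro i
      rw [← Finset.prod_filter]
      by_cases hi : 𝒞.filter (fun p => N + 1 - i ∈ p.1) = ∅
      · simp only [hH, if_pos hi]
        rw [hi, Finset.prod_empty]
      · obtain ⟨p₀, hp₀⟩ := Finset.nonempty_of_ne_empty hi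
        have hsing : 𝒞.filter (fun p => N + 1 - i ∈ p.1) = {p₀} := by
          refine Finset.eq_singleton_iff_unique_mem.2 ⟨hp₀, fun q hq => ?_⟩
          rw [Finset.mem_filter] at hp₀ hq
          exact hdisj.elim_finset hq.1 hp₀.1 (N + 1 - i) hq.2 hp₀.2
        simp only [hH, if_neg hi]
        rw [hsing, Finset.sum_singleton, Finset.prod_singleton]
    -- (b) per polymer, reindex the covered slots `i` by the times `τ = N + 1 - i`
    have h4c : ∀ p ∈ 𝒞, ∏ i ∈ Finset.range (N + 1),
        (if N + 1 - i ∈ p.1 then C / r * ‖act N p.1 p.2 (N + 1 - i)‖ else 1) =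
        (C / r) ^ p.1.card * ∏ τ ∈ p.1, ‖act N p.1 p.2 τ‖ := by
      intro p hp
      have hsub := (h𝒞 p hp).1
      rw [← Finset.prod_filter, show (C / r) ^ p.1.card * ∏ τ ∈ p.1, ‖act N p.1 p.2 τ‖ =
        ∏ τ ∈ p.1, (C / r * ‖act N p.1 p.2 τ‖) by
          rw [Finset.prod_mul_distrib, Finset.prod_const]]
      refine Finset.prod_nbij' (fun i => N + 1 - i) (fun τ => N + 1 - τ) ?_ ?_ ?_ ?_ ?_
      · intro i hi
        exact (Finset.mem_filter.1 hi).2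
      · intro τ hτ
        have h1 := Finset.mem_Icc.1 (hsub hτ)
        refine Finset.mem_filter.2 ⟨Finset.mem_range.2 (by omega), ?_⟩
        rwa [show N + 1 - (N + 1 - τ) = τ by omega]
      · intro i hi
        have := Finset.mem_range.1 (Finset.mem_filter.1 hi).1
        omega
      · intro τ hτ
        have h1 := Finset.mem_Icc.1 (hsub hτ)
        omega
      · intro i _
        rfl
    calc ∏ i ∈ Finset.range (N + 1), H i
        = ∏ i ∈ Finset.range (N + 1), ∏ p ∈ 𝒞,
            (if N + 1 - i ∈ p.1 then C / r * ‖act N p.1 p.2 (N + 1 - i)‖ else 1) :=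
          Finset.prod_congr rfl fun i _ => h4a i
      _ = ∏ p ∈ 𝒞, ∏ i ∈ Finset.range (N + 1),
            (if N + 1 - i ∈ p.1 then C / r * ‖act N p.1 p.2 (N + 1 - i)‖ else 1) :=
          Finset.prod_comm
      _ = _ := Finset.prod_congr rfl h4c
  -- assembly
  calc ‖((List.range (N + 1)).map f).prod‖
      = ‖f 0 * ((List.range N).map (fun j => f (j + 1))).prod‖ := by rw [hsplit, List.prod_cons]
    _ ≤ ‖f 0‖ * ‖((List.range N).map (fun j => f (j + 1))).prod‖ := norm_mul_le _ _
    _ ≤ H 0 * (C * r ^ N * ∏ j ∈ Finset.range N, H (j + 1)) :=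
        mul_le_mul hhead htail (norm_nonneg _) ((norm_nonneg _).trans hhead)
    _ = C * r ^ N * ∏ i ∈ Finset.range (N + 1), H i := by
        rw [Finset.prod_range_succ']
        ring
    _ = _ := by rw [hprod]

/-- **Dilute polymer gas bound** (the `R = 0` Kotecký–Preiss / Mayer estimate, no cluster expansion
needed): if non-negative activities `w` have partial sums `Σ_{p ∈ B} w p ≤ W` over finite sets `B`
of admissible polymers, then any family `F` indexed by (an injective image of) NON-EMPTY finite
collections of admissible polymers with `‖F 𝒞‖ ≤ K ∏_{p ∈ 𝒞} w p` is absolutely summable with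
`Σ ‖F‖ ≤ K (e^W − 1)`: `Σ_{∅ ≠ 𝒞 ⊆ B} ∏ w = ∏_{p∈B} (1 + w p) − 1 ≤ e^{Σ_B w} − 1`. [folklore] -/
theorem summable_norm_le_exp_sub_one_of_gas {α E κ : Type*} [DecidableEq α]
    [SeminormedAddCommGroup E] (w : α → ℝ) (hw : ∀ a, 0 ≤ w a) (P : α → Prop) (W : ℝ)
    (hW : ∀ B : Finset α, (∀ a ∈ B, P a) → ∑ a ∈ B, w a ≤ W)
    (S : κ → Finset α) (hS : Function.Injective S) (hne : ∀ k, (S k).Nonempty)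
    (hP : ∀ k, ∀ a ∈ S k, P a) (F : κ → E) (K : ℝ) (hK : 0 ≤ K)
    (hF : ∀ k, ‖F k‖ ≤ K * ∏ a ∈ S k, w a) :
    Summable (fun k => ‖F k‖) ∧ ∑' k, ‖F k‖ ≤ K * (Real.exp W - 1) := by
  have hsum : ∀ U : Finset κ, ∑ k ∈ U, ‖F k‖ ≤ K * (Real.exp W - 1) := by
    intro U
    set B : Finset α := U.biUnion S with hB
    have hBP : ∀ a ∈ B, P a := by
      intro a ha
      obtain ⟨k, -, hk⟩ := Finset.mem_biUnion.1 ha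
      exact hP k a hk
    calc ∑ k ∈ U, ‖F k‖ ≤ ∑ k ∈ U, K * ∏ a ∈ S k, w a := Finset.sum_le_sum fun k _ => hF k
      _ = K * ∑ A ∈ U.image S, ∏ a ∈ A, w a := by
          rw [Finset.mul_sum, Finset.sum_image fun x _ y _ h => hS h]
      _ ≤ K * ∑ A ∈ B.powerset.erase ∅, ∏ a ∈ A, w a := by
          refine mul_le_mul_of_nonneg_left ?_ hK
          refine Finset.sum_le_sum_of_subset_of_nonneg ?_ fun A _ _ =>
            Finset.prod_nonneg fun a _ => hw a
          intro A hA
          obtain ⟨k, hk, rfl⟩ := Finset.mem_image.1 hA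
          refine Finset.mem_erase.2 ⟨(hne k).ne_empty, Finset.mem_powerset.2 ?_⟩
          exact Finset.subset_biUnion_of_mem S hk
      _ = K * (∏ a ∈ B, (1 + w a) - 1) := by
          rw [Finset.sum_erase_eq_sub (Finset.empty_mem_powerset B), Finset.prod_empty,
            Finset.prod_one_add]
      _ ≤ K * (Real.exp W - 1) := by
          gcongr
          calc ∏ a ∈ B, (1 + w a) ≤ ∏ a ∈ B, Real.exp (w a) :=
                Finset.prod_le_prod (fun a _ => by linarith [hw a]) fun a _ => by
                  linarith [Real.add_one_le_exp (w a)]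
            _ = Real.exp (∑ a ∈ B, w a) := (Real.exp_sum B w).symm
            _ ≤ Real.exp W := Real.exp_le_exp.2 (hW B hBP)
  exact ⟨summable_of_sum_le (fun _ => norm_nonneg _) hsum,
    Real.tsum_le_of_sum_le (fun _ => norm_nonneg _) hsum⟩

/-- **Partial sums of the activities from the anchor slices.** Slicing the polymers `(A, ι)`,
`A ⊆ {1, …, N+1}`, `|A| ≥ 2`, by their anchor `max A = τ₀ ∈ {1, …, N+1}`, the `ℝ≥0∞`-valued slice
bounds `Σ'_{max A = τ₀} w ≤ δ` give real partial sums `Σ_{p ∈ B} w p ≤ (N+1) δ`. [folklore] -/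
theorem sum_activity_le_of_slices (N : ℕ) {δ : ℝ} (hδ : 0 ≤ δ) (wt : Finset ℕ × ℕ → ℝ)
    (hwt : ∀ p, 0 ≤ wt p)
    (hact : ∀ τ₀ : ℕ,
      (∑' p : {p : Finset ℕ × ℕ // p.1 ⊆ Finset.Icc 1 (N + 1) ∧ 2 ≤ p.1.card ∧ p.1.max = ↑τ₀},
        ENNReal.ofReal (wt p.1)) ≤ ENNReal.ofReal δ)
    (B : Finset (Finset ℕ × ℕ)) (hB : ∀ p ∈ B, p.1 ⊆ Finset.Icc 1 (N + 1) ∧ 2 ≤ p.1.card) :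
    ∑ p ∈ B, wt p ≤ (N + 1) * δ := by
  classical
  have hmaps : ∀ p ∈ B,
      p.1.max ∈ (Finset.Icc 1 (N + 1)).image (fun τ₀ : ℕ => (τ₀ : WithBot ℕ)) := by
    intro p hp
    have hne : p.1.Nonempty := by
      rw [← Finset.card_pos]
      have := (hB p hp).2
      omega
    exact Finset.mem_image.2 ⟨p.1.max' hne, (hB p hp).1 (Finset.max'_mem _ hne),
      Finset.coe_max' hne⟩
  have hslice : ∀ τ₀ : ℕ, ∑ p ∈ B with p.1.max = ↑τ₀, wt p ≤ δ := by
    intro τ₀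
    have hmem : ∀ p ∈ B.filter (fun p => p.1.max = ↑τ₀),
        p.1 ⊆ Finset.Icc 1 (N + 1) ∧ 2 ≤ p.1.card ∧ p.1.max = ↑τ₀ := by
      intro p hp
      rw [Finset.mem_filter] at hp
      exact ⟨(hB p hp.1).1, (hB p hp.1).2, hp.2⟩
    have h1 : ENNReal.ofReal (∑ p ∈ B with p.1.max = ↑τ₀, wt p) ≤ ENNReal.ofReal δ := by
      rw [ENNReal.ofReal_sum_of_nonneg (fun p _ => hwt p)]
      calc ∑ p ∈ B with p.1.max = ↑τ₀, ENNReal.ofReal (wt p)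
          = ∑ q ∈ (B.filter (fun p => p.1.max = ↑τ₀)).subtype
              (fun p : Finset ℕ × ℕ => p.1 ⊆ Finset.Icc 1 (N + 1) ∧ 2 ≤ p.1.card ∧ p.1.max = ↑τ₀),
              ENNReal.ofReal (wt (q : Finset ℕ × ℕ)) :=
            (Finset.sum_subtype_of_mem (fun p => ENNReal.ofReal (wt p)) hmem).symm
        _ ≤ _ := ENNReal.sum_le_tsum _
        _ ≤ ENNReal.ofReal δ := hact τ₀
    exact (ENNReal.ofReal_le_ofReal_iff hδ).1 h1
  calc ∑ p ∈ B, wt p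
      = ∑ j ∈ (Finset.Icc 1 (N + 1)).image (fun τ₀ : ℕ => (τ₀ : WithBot ℕ)),
          ∑ p ∈ B with p.1.max = j, wt p := (Finset.sum_fiberwise_of_maps_to hmaps _).symm
    _ = ∑ τ₀ ∈ Finset.Icc 1 (N + 1), ∑ p ∈ B with p.1.max = ↑τ₀, wt p := by
        have hinj : Set.InjOn (fun τ₀ : ℕ => (τ₀ : WithBot ℕ)) ↑(Finset.Icc 1 (N + 1)) :=
          fun x _ y _ h => WithBot.coe_injective h
        rw [Finset.sum_image hinj]
    _ ≤ ∑ τ₀ ∈ Finset.Icc 1 (N + 1), δ := Finset.sum_le_sum fun τ₀ _ => hslice τ₀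
    _ = (N + 1) * δ := by
        rw [Finset.sum_const, Nat.card_Icc, nsmul_eq_mul]
        push_cast
        ring

/-- **Stub A `stub_dilutePolymerGasSum` — the abstract De Roeck–Kupiainen summation theorem in the
dissipative case `R = 0`** (the registered stub of line `kinetic-polymer-gas-on-the-time-axis`,
verbatim; De Roeck–Kupiainen arXiv:1005.1080 §2.2 eq. (2.12), Ass. 2.2–2.3, Thm 2.4 with no unit
eigenvalue; Kotecký–Preiss weights `r^{|A|}`, `r = C/(1−g)`). In a real normed ring, if
`‖Tⁿ‖ ≤ C(1−g)ⁿ`, `‖X‖ ≤ 1`, `1 ≤ C`, `0 < g < 1`, every anchor slice of the weighted activities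
sums to `≤ δ ≤ g/4`, and `Z N − X Tᴺ` has the polymer representation over non-empty collections of
polymers with pairwise disjoint supports, then `Σ_N ‖Z N − X Tᴺ‖ ≤ 8Cδ/g²`. Proof: per collection
`‖term‖ ≤ C(1−g)ᴺ ∏_{p} w(p)` (`norm_timeOrdered_prod_le`), `Σ_{𝒞≠∅} ∏ w ≤ e^{(N+1)δ} − 1`
(`summable_norm_le_exp_sub_one_of_gas`, `sum_activity_le_of_slices`), `‖Z N − X Tᴺ‖ ≤ Σ ‖term‖`
(`HasSum.norm_le_of_bounded`), and
`Σ_N C(1−g)ᴺ(e^{(N+1)δ} − 1) = C(e^δ−1)/(g(1−(1−g)e^δ)) ≤ 4Cδ/g²`. [folklore] -/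
theorem stub_dilutePolymerGasSum :
    ∀ (R : Type*) [NormedRing R] (T X : R) (Z : ℕ → R) (act : ℕ → Finset ℕ → ℕ → ℕ → R)
      (C g δ : ℝ), 1 ≤ C → 0 < g → g < 1 → 0 ≤ δ → δ ≤ g / 4 →
      (∀ n : ℕ, ‖T ^ n‖ ≤ C * (1 - g) ^ n) → ‖X‖ ≤ 1 →
      (∀ N τ₀ : ℕ,
        (∑' p : {p : Finset ℕ × ℕ // p.1 ⊆ Finset.Icc 1 (N + 1) ∧ 2 ≤ p.1.card ∧ p.1.max = ↑τ₀},
          ENNReal.ofReal ((C / (1 - g)) ^ p.1.1.card * ∏ τ ∈ p.1.1, ‖act N p.1.1 p.1.2 τ‖))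
          ≤ ENNReal.ofReal δ) →
      (∀ N : ℕ, HasSum
        (fun 𝒞 : {𝒞 : Finset (Finset ℕ × ℕ) // 𝒞.Nonempty ∧
            (∀ p ∈ 𝒞, p.1 ⊆ Finset.Icc 1 (N + 1) ∧ 2 ≤ p.1.card) ∧
            (𝒞 : Set (Finset ℕ × ℕ)).PairwiseDisjoint Prod.fst} =>
          ((List.range (N + 1)).map (fun i : ℕ =>
            if (𝒞.1.filter (fun p => N + 1 - i ∈ p.1)) = ∅ then (if i = 0 then X else T)
            else ∑ p ∈ 𝒞.1.filter (fun p => N + 1 - i ∈ p.1), act N p.1 p.2 (N + 1 - i))).prod)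
        (Z N - X * T ^ N)) →
      Summable (fun N : ℕ => ‖Z N - X * T ^ N‖) ∧
        ∑' N : ℕ, ‖Z N - X * T ^ N‖ ≤ 8 * C * δ / g ^ 2 := by
  intro R _ T X Z act C g δ hC hg hg1 hδ hδg hT hX hact hZ
  have hr : 0 < 1 - g := by linarith
  have hr1 : 1 - g ≤ 1 := by linarith
  have hC0 : 0 ≤ C := zero_le_one.trans hC
  -- per-`N` bound: `‖Z N - X Tᴺ‖ ≤ C (1-g)ᴺ (e^{(N+1)δ} - 1)`
  have hN : ∀ N : ℕ, ‖Z N - X * T ^ N‖ ≤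
      C * (1 - g) ^ N * (Real.exp ((N + 1) * δ) - 1) := by
    intro N
    have hwt0 : ∀ p : Finset ℕ × ℕ,
        0 ≤ (C / (1 - g)) ^ p.1.card * ∏ τ ∈ p.1, ‖act N p.1 p.2 τ‖ :=
      fun p => mul_nonneg (pow_nonneg (div_nonneg hC0 hr.le) _)
        (Finset.prod_nonneg fun _ _ => norm_nonneg _)
    obtain ⟨hs, hle⟩ := summable_norm_le_exp_sub_one_of_gas
      (fun p : Finset ℕ × ℕ => (C / (1 - g)) ^ p.1.card * ∏ τ ∈ p.1, ‖act N p.1 p.2 τ‖) hwt0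
      (fun p : Finset ℕ × ℕ => p.1 ⊆ Finset.Icc 1 (N + 1) ∧ 2 ≤ p.1.card) ((N + 1) * δ)
      (sum_activity_le_of_slices N hδ _ hwt0 (hact N))
      (fun 𝒞 : {𝒞 : Finset (Finset ℕ × ℕ) // 𝒞.Nonempty ∧
          (∀ p ∈ 𝒞, p.1 ⊆ Finset.Icc 1 (N + 1) ∧ 2 ≤ p.1.card) ∧
          (𝒞 : Set (Finset ℕ × ℕ)).PairwiseDisjoint Prod.fst} => 𝒞.1)
      Subtype.val_injective (fun 𝒞 => 𝒞.2.1) (fun 𝒞 => 𝒞.2.2.1) _ (C * (1 - g) ^ N)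
      (by positivity)
      (fun 𝒞 => norm_timeOrdered_prod_le T X act hC hr hr1 hT hX N 𝒞.1 𝒞.2.2.1 𝒞.2.2.2)
    exact ((hZ N).norm_le_of_bounded hs.hasSum fun _ => le_rfl).trans hle
  -- the `N`-sum: two geometric series
  set E : ℝ := Real.exp δ with hE
  have hE1 : E - 1 ≤ 2 * δ := by
    have h := Real.abs_exp_sub_one_le (x := δ) (by rw [abs_of_nonneg hδ]; linarith)
    rw [abs_of_nonneg hδ] at h
    exact (le_abs_self _).trans h
  have hE0 : 1 ≤ E := Real.one_le_exp hδ
  have hq0 : 0 ≤ (1 - g) * E := by positivity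
  have h1 : (1 - g) * E ≤ (1 - g) * (1 + 2 * δ) := mul_le_mul_of_nonneg_left (by linarith) hr.le
  have h1' : (1 - g) * (1 + 2 * δ) = 1 + 2 * δ - g - 2 * (g * δ) := by ring
  have h2 : 0 ≤ g * δ := mul_nonneg hg.le hδ
  have hD : g / 2 ≤ 1 - (1 - g) * E := by linarith
  have hDpos : 0 < 1 - (1 - g) * E := by linarith
  have hq1 : (1 - g) * E < 1 := by linarith
  have hgeom : ∀ N : ℕ, C * (1 - g) ^ N * (Real.exp ((N + 1) * δ) - 1) =
      C * E * ((1 - g) * E) ^ N - C * (1 - g) ^ N := by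
    intro N
    have : Real.exp ((N + 1) * δ) = E ^ (N + 1) := by
      rw [hE, ← Real.exp_nat_mul]
      push_cast
      ring_nf
    rw [this, mul_pow]
    ring
  have hsumc : HasSum (fun N : ℕ => C * (1 - g) ^ N * (Real.exp ((N + 1) * δ) - 1))
      (C * E * (1 - (1 - g) * E)⁻¹ - C * (1 - (1 - g))⁻¹) := by
    simp_rw [hgeom]
    exact ((hasSum_geometric_of_lt_one hq0 hq1).mul_left (C * E)).sub
      ((hasSum_geometric_of_lt_one hr.le (by linarith)).mul_left C)
  have hsum : Summable (fun N : ℕ => ‖Z N - X * T ^ N‖) :=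
    hsumc.summable.of_nonneg_of_le (fun N => norm_nonneg _) hN
  refine ⟨hsum, ?_⟩
  have hfin : C * E * (1 - (1 - g) * E)⁻¹ - C * (1 - (1 - g))⁻¹ ≤ 8 * C * δ / g ^ 2 := by
    have hg0 : g ≠ 0 := hg.ne'
    have hD0 : 1 - (1 - g) * E ≠ 0 := hDpos.ne'
    have key : C * E * (1 - (1 - g) * E)⁻¹ - C * (1 - (1 - g))⁻¹ =
        C * (E - 1) / (g * (1 - (1 - g) * E)) := by
      rw [sub_sub_cancel, eq_div_iff (mul_ne_zero hg0 hD0)]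
      have hx : (C * E * (1 - (1 - g) * E)⁻¹ - C * g⁻¹) * (g * (1 - (1 - g) * E)) =
          C * E * g * ((1 - (1 - g) * E)⁻¹ * (1 - (1 - g) * E)) -
            C * (1 - (1 - g) * E) * (g⁻¹ * g) := by
        ring
      rw [hx, inv_mul_cancel₀ hD0, inv_mul_cancel₀ hg0]
      ring
    rw [key]
    calc C * (E - 1) / (g * (1 - (1 - g) * E)) ≤ C * (2 * δ) / (g * (g / 2)) := by
          apply div_le_div₀
          · positivity
          · exact mul_le_mul_of_nonneg_left hE1 hC0
          · positivity
          · exact mul_le_mul_of_nonneg_left hD hg.le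
      _ = 4 * C * δ / g ^ 2 := by
          field_simp
          ring
      _ ≤ 8 * C * δ / g ^ 2 := by
          apply div_le_div_of_nonneg_right _ (by positivity)
          nlinarith [mul_nonneg hC0 hδ]
  exact (hasSum_le hN hsum.hasSum hsumc).trans hfin

end Summit.AtomisticToContinuum.FouriersLaw.Theorems.DrudeDissolution.KineticPolymerGasOnTheTimeAxis

end
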